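import Summits.PneNP.PneNP.Theorems.ExpanderLinearGeneratorsColumnTwoFinalScale
import Summits.PneNP.PneNP.Theses.ExpanderLinearGenerators

/-!
# PneNP / ExpanderLinearGenerators — `ExpansionForcesDepthFregeSize` is equivalent to its
column-weight-`≥ 3` case

Route `PneNP/ExpanderLinearGenerators`, crux stmt-PneNP-11442
(`Summit.PneNP.PneNP.Theses.ExpanderLinearGenerators.ExpansionForcesDepthFregeSize`, the
expansion-scale law, uniform in the numbers of variables and rows). Its column-weight-`≤ 2` slice
is a theorem of the tree (`ColumnTwo.expansionForcesDepthFregeSize_of_colWeight_le_two`,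
unconditional), so the crux is EQUIVALENT to its restriction to systems in which some variable
occurs in at least three equations — the hypergraph case, which contains bounded-depth Frege lower
bounds for expanding (e.g. random) `ℓ`-CNFs and is open in print (companion for crux 3:
`linearGeneratorDepthFregeHard_iff_three_le_colWeight`).

* `expansionForcesDepthFregeSize_iff_three_le_colWeight` — the equivalence.

References: J. Krajíček, *Proof complexity* (CUP 2019), Problem 19.4.5; S. Gryaznov,
N. Talebanfard, arXiv:2403.02275 (2024), abstract (status of the random-CNF case).
-/

namespace Summit.PneNP.PneNP.Theorems

open Literature.Computability.MetaComplexity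
open Literature.Computability.Complexity (PropForm)

/-- **Crux 2 is its column-weight-`≥ 3` case.** `ExpansionForcesDepthFregeSize` holds iff it
holds for the systems `E` in which some variable lies in the support of at least three equations:
the complementary case is the unconditional theorem
`ColumnTwo.expansionForcesDepthFregeSize_of_colWeight_le_two`; exponents combine by `min` and
thresholds by `max` (with `R ≥ 1`, so that `2^(r^(min ε₁ ε₂)) ≤ 2^(r^εᵢ)`). [Krajíček 2019,
Problem 19.4.5; the column-weight-two slice by routing (Urquhart–Fu 1996, Ben-Sasson 2002)] -/
theorem expansionForcesDepthFregeSize_iff_three_le_colWeight :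
    Summit.PneNP.PneNP.Theses.ExpanderLinearGenerators.ExpansionForcesDepthFregeSize ↔
    ∀ (ℓ d : ℕ), 1 ≤ ℓ → ∃ ε : ℝ, 0 < ε ∧ ∃ R : ℝ, ∀ r : ℝ, R ≤ r →
      ∀ (n m : ℕ) (E : Fin m → LinEqMod 2 n),
      (∃ j : Fin n, 3 ≤ (Finset.univ.filter fun i => j ∈ (E i).supp).card) →
      (∀ i, (E i).supp.card ≤ ℓ) →
      IsBoundaryExpander (fun i => (E i).supp.map Fin.valEmbedding) r (3 / 4 * ℓ) →
      ¬ SystemSat E Finset.univ →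
      ∀ π : List (PropForm ℕ),
        textbookFrege.IsDepthProofOf d π (PropForm.neg (PropForm.ofCNF (sumEncoding 1 E))) →
          (2 : ℝ) ^ (r ^ ε) ≤ (proofSize π : ℝ) := by
  unfold Summit.PneNP.PneNP.Theses.ExpanderLinearGenerators.ExpansionForcesDepthFregeSize
  constructor
  · intro h ℓ d hℓ
    obtain ⟨ε, hε, R, hR⟩ := h ℓ d hℓ
    exact ⟨ε, hε, R, fun r hr n m E _ hsparse hexp hunsat π hπ => hR r hr n m E hsparse hexp hunsat π hπ⟩
  · intro h ℓ d hℓ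
    obtain ⟨ε₁, hε₁, R₁, hR₁⟩ := ColumnTwo.expansionForcesDepthFregeSize_of_colWeight_le_two ℓ d hℓ
    obtain ⟨ε₂, hε₂, R₂, hR₂⟩ := h ℓ d hℓ
    refine ⟨min ε₁ ε₂, lt_min hε₁ hε₂, max (max R₁ R₂) 1, ?_⟩
    intro r hr n m E hsparse hexp hunsat π hπ
    have hr1 : (1 : ℝ) ≤ r := le_trans (le_max_right _ _) hr
    have hmono : ∀ {ε : ℝ}, min ε₁ ε₂ ≤ ε → (2 : ℝ) ^ (r ^ min ε₁ ε₂) ≤ (2 : ℝ) ^ (r ^ ε) :=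
      fun hle => Real.rpow_le_rpow_of_exponent_le one_le_two
        (Real.rpow_le_rpow_of_exponent_le hr1 hle)
    by_cases hcol : ∀ j : Fin n, (Finset.univ.filter fun i => j ∈ (E i).supp).card ≤ 2
    · exact (hmono (min_le_left _ _)).trans
        (hR₁ r (le_trans (le_trans (le_max_left _ _) (le_max_left _ _)) hr) n m E hcol hsparse hexp
          hunsat π hπ)
    · push Not at hcol
      obtain ⟨j, hj⟩ := hcol
      exact (hmono (min_le_right _ _)).trans
        (hR₂ r (le_trans (le_trans (le_max_right _ _) (le_max_left _ _)) hr) n m E ⟨j, hj⟩ hsparse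
          hexp hunsat π hπ)

end Summit.PneNP.PneNP.Theorems
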